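import Summits.ResolutionOfSingularities.ResolutionOfSingularities.Theses.FrobeniusLadder
import Summits.ResolutionOfSingularities.ResolutionOfSingularities.Theorems.FrobeniusLadderFRationalModificationCertifiedModel
import Summits.ResolutionOfSingularities.ResolutionOfSingularities.Theorems.FrobeniusLadderFRationalModificationReduction
import HarnessLib

/-!
# The crux `FRationalModification` from a POINTWISE-certified model of a rung-2 variety
(crux `FrobeniusLadder.FRationalModification`, stmt-ResolutionOfSingularities-15316, line `birth`, chain D —
the weakest sufficient statement of the line, in the vocabulary of the route file)

Line `birth` closes the crux from "F-injective Cartier hull" statements (chains A/B/C: a proper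
birational `W' → Y` with an effective Cartier DIVISOR `D'`, `W'` regular off `Supp D'`, Cohen–Macaulay
F-injective boundary rings on it). The consumer, however, is POINTWISE (`CertifiedModel.rungThree_of_certificate`:
a domain stalk `𝒪` with `t ∈ 𝔪 ∖ 0`, `𝒪[1/t]` regular and `𝒪/(t)` Cohen–Macaulay F-injective is rung-3,
by the Fedder–Watanabe inversion with pointwise test exponents descended from F-finite submodels), so the
global divisor is a convenience: this file records chain D,

  (PointwiseHullOfRungTwo) every INTEGRAL separated finite-type `Y/k` (`char k = p`) with rung-2 stalks
  has a proper birational `W' → Y` every stalk of which is EITHER regular OR a domain carrying a ring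
  certificate `t` (`t ∈ 𝔪 ∖ 0`, `𝒪[1/t]` a regular ring, `𝒪/(t)` Cohen–Macaulay and F-injective in the
  route's inline system-of-parameters language),

with `fRationalModification_of_pointwiseHullOfRungTwo : PointwiseHullOfRungTwo → FRationalModification`
(sorry-free, no named fact) and `pointwiseHull_of_cartierHull` (an F-injective Cartier hull is a
pointwise-certified model: off `Supp D'` regular; on it the local equation of `D'` is the certificate,
`𝒪[1/t]` regular by `TestElement.isRegularRing_away_of_generizations`). PointwiseHullOfRungTwo is thus
implied by chain C's `HullOfRungTwo` (hence by chains A/B), still implied by the summit (a resolution: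
every stalk regular), NOT known from the crux (an F-rational, even F-regular, singular point need not
carry a certificate: rational double points of type `D`, `E`), and — unlike the Cartier-hull forms,
which need the tree's `IsEffectiveCartier` / `stalkIdeal` — it is stated over Mathlib and the
Statement's module alone, i.e. it elaborates in the route file and can be PROMOTED to a route item
verbatim (`Lines/birth.lean` v5, `PromoteSignature.lean`).

## References

* R. Fedder, K.-i. Watanabe, *A characterization of F-regularity in terms of F-purity*, MSRI Publ. 15
  (1989), Prop. 2.13. [FedderWatanabe1989]
* M. Hochster, C. Huneke, *Tight closure and strong F-regularity*, Mém. SMF 38 (1989), Thm. 3.4.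
  [HochsterHuneke1989]
-/

-- single-problem summit: the doubled namespace component `ResolutionOfSingularities` is forced
set_option linter.dupNamespace false

noncomputable section

open CategoryTheory AlgebraicGeometry TopologicalSpace IsLocalRing
open Literature.AlgebraicGeometry.Resolution
open Summit.ResolutionOfSingularities.ResolutionOfSingularities.Theses.FrobeniusLadder

namespace Summit.ResolutionOfSingularities.ResolutionOfSingularities.Theorems.FRationalModification.PointwiseHull

/-- **Chain D: the crux from a pointwise-certified model of every integral rung-2 variety** (no Cartier
divisor, no Cohen–Macaulay convenience beyond the antecedent, no named fact; stated over Mathlib and the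
Statement's module only). If every integral separated finite-type `Y/k` (`char k = p`) with rung-2 stalks
admits a proper birational `W' → Y` all of whose stalks are regular or certified domains (hypothesis
`hP`), then `FRationalModification` holds: reduce to the integral rung-2 components
(`Reduction.stub_reduction`); regular stalks are rung-3 (`Negative.rungThree_of_isRegularLocalRing`),
certified ones by `CertifiedModel.rungThree_of_certificate`. [cite: FedderWatanabe1989, Prop. 2.13;
HochsterHuneke1989, Thm. 3.4] -/
theorem fRationalModification_of_pointwiseHullOfRungTwo
    (hP : ∀ (p : ℕ) [Fact p.Prime] (k : Type) [Field k] [CharP k p] (Y : Scheme.{0})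
      (g : Y ⟶ Spec (.of k)) [IsSeparated g] [LocallyOfFiniteType g] [QuasiCompact g] [IsIntegral Y],
      (∀ y : Y, IsDomain (Y.presheaf.stalk y) ∧ ∀ d : ℕ, ringKrullDim (Y.presheaf.stalk y) = d →
        ∀ s : Fin d → Y.presheaf.stalk y, (Ideal.span (Set.range s)).radical.IsMaximal →
          RingTheory.Sequence.IsWeaklyRegular (Y.presheaf.stalk y) (List.ofFn s) ∧
          ∀ w : Y.presheaf.stalk y, (∃ e : ℕ, w ^ p ^ e ∈
            Ideal.span ((fun z : Y.presheaf.stalk y => z ^ p ^ e) ''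
              (Ideal.span (Set.range s) : Set (Y.presheaf.stalk y)))) →
            w ∈ Ideal.span (Set.range s)) →
      ∃ (W' : Scheme.{0}) (π : W' ⟶ Y), IsProper π ∧ IsBirational π ∧ ∀ w : W',
        IsRegularLocalRing (W'.presheaf.stalk w) ∨
        (IsDomain (W'.presheaf.stalk w) ∧
          ∃ t : W'.presheaf.stalk w, t ∈ maximalIdeal (W'.presheaf.stalk w) ∧ t ≠ 0 ∧
            IsRegularRing (Localization.Away t) ∧
            ∀ d : ℕ, ringKrullDim (W'.presheaf.stalk w ⧸ Ideal.span {t}) = d →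
              ∀ u : Fin d → W'.presheaf.stalk w ⧸ Ideal.span {t},
                (Ideal.span (Set.range u)).radical.IsMaximal →
                  RingTheory.Sequence.IsWeaklyRegular (W'.presheaf.stalk w ⧸ Ideal.span {t})
                    (List.ofFn u) ∧
                  ∀ y : W'.presheaf.stalk w ⧸ Ideal.span {t}, (∃ e : ℕ, y ^ p ^ e ∈
                    Ideal.span ((fun z : W'.presheaf.stalk w ⧸ Ideal.span {t} => z ^ p ^ e) ''
                      (Ideal.span (Set.range u) : Set (W'.presheaf.stalk w ⧸ Ideal.span {t})))) →
                    y ∈ Ideal.span (Set.range u))) :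
    FRationalModification := by
  intro p hp k _ _ X f hsep hft hqc _ hX₁
  haveI : Fact p.Prime := ⟨hp⟩
  haveI := hsep; haveI := hft; haveI := hqc
  refine Reduction.stub_reduction p k X f (fun Y g hs hl hq hY h₂ => ?_) hX₁
  haveI := hs; haveI := hl; haveI := hq; haveI := hY
  obtain ⟨W', π', hπ', hbir', hcert⟩ := hP p k Y g h₂
  haveI := hπ'
  refine ⟨W', π', inferInstance, hbir', fun w => ?_⟩
  haveI : CharP (W'.presheaf.stalk w) p := Negative.charP_stalk (π' ≫ g) w
  rcases hcert w with hreg | ⟨hdom, t, htm, ht0, haway, hc⟩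
  · -- regular, hence rung-3
    exact Negative.rungThree_of_isRegularLocalRing hp _ hreg
  · -- a ring certificate: Fedder–Watanabe inversion with descended pointwise test exponents
    haveI := hdom
    exact ⟨hdom, CertifiedModel.rungThree_of_certificate p (π' ≫ g) w
      (Or.inr ⟨t, htm, ht0, haway, hc⟩)⟩

/-- **An F-injective Cartier hull is a pointwise-certified model.** If `W'` (locally of finite type over
a field) carries an effective Cartier `D'` with `W'` regular off `Supp D'` and, on `Supp D'`, domain
stalks with Cohen–Macaulay F-injective boundary rings `𝒪_{W',w}/D'_w`, then every stalk of `W'` is regular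
or a certified domain: on `Supp D'` a local equation `t` of `D'` (`CartierCertificate.exists_localEquation`,
`D'_w = (t)`) is the certificate, with `𝒪[1/t]` regular because the generizations of `w` at which `t`
becomes a unit lie off `Supp D'` (`CartierCertificate.not_isUnit_of_mem_support`,
`TestElement.isRegularRing_away_of_generizations`). [folklore] -/
theorem pointwiseHull_of_cartierHull (p : ℕ) {k : Type} [Field k] {W' : Scheme.{0}}
    (f : W' ⟶ Spec (.of k)) [LocallyOfFiniteType f] {D' : W'.IdealSheafData}
    (hD' : IsEffectiveCartier D')
    (hreg : ∀ w : W', w ∉ D'.support → IsRegularLocalRing (W'.presheaf.stalk w))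
    (hcert : ∀ w : W', w ∈ D'.support → IsDomain (W'.presheaf.stalk w) ∧
      ∀ d : ℕ, ringKrullDim (W'.presheaf.stalk w ⧸ stalkIdeal D' w) = d →
        ∀ t : Fin d → W'.presheaf.stalk w ⧸ stalkIdeal D' w,
          (Ideal.span (Set.range t)).radical.IsMaximal →
            RingTheory.Sequence.IsWeaklyRegular (W'.presheaf.stalk w ⧸ stalkIdeal D' w)
              (List.ofFn t) ∧
            ∀ y : W'.presheaf.stalk w ⧸ stalkIdeal D' w, (∃ e : ℕ, y ^ p ^ e ∈
              Ideal.span ((fun z : W'.presheaf.stalk w ⧸ stalkIdeal D' w => z ^ p ^ e) ''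
                (Ideal.span (Set.range t) : Set (W'.presheaf.stalk w ⧸ stalkIdeal D' w)))) →
              y ∈ Ideal.span (Set.range t))
    (w : W') :
    IsRegularLocalRing (W'.presheaf.stalk w) ∨
    (IsDomain (W'.presheaf.stalk w) ∧
      ∃ t : W'.presheaf.stalk w, t ∈ maximalIdeal (W'.presheaf.stalk w) ∧ t ≠ 0 ∧
        IsRegularRing (Localization.Away t) ∧
        ∀ d : ℕ, ringKrullDim (W'.presheaf.stalk w ⧸ Ideal.span {t}) = d →
          ∀ u : Fin d → W'.presheaf.stalk w ⧸ Ideal.span {t},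
            (Ideal.span (Set.range u)).radical.IsMaximal →
              RingTheory.Sequence.IsWeaklyRegular (W'.presheaf.stalk w ⧸ Ideal.span {t})
                (List.ofFn u) ∧
              ∀ y : W'.presheaf.stalk w ⧸ Ideal.span {t}, (∃ e : ℕ, y ^ p ^ e ∈
                Ideal.span ((fun z : W'.presheaf.stalk w ⧸ Ideal.span {t} => z ^ p ^ e) ''
                  (Ideal.span (Set.range u) : Set (W'.presheaf.stalk w ⧸ Ideal.span {t})))) →
                y ∈ Ideal.span (Set.range u)) := by
  haveI : IsLocallyNoetherian W' := LocallyOfFiniteType.isLocallyNoetherian f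
  by_cases hw : w ∈ D'.support
  · obtain ⟨hdom, hc⟩ := hcert w hw
    obtain ⟨t, htm, ht0, hDt, -⟩ := CartierCertificate.exists_localEquation hD' hw
    have hreg'' : ∀ (x' : W') (hx' : x' ⤳ w), IsUnit ((W'.presheaf.stalkSpecializes hx').hom t) →
        IsRegularLocalRing (W'.presheaf.stalk x') := fun x' hx' hu =>
      hreg x' fun hs => CartierCertificate.not_isUnit_of_mem_support hx' hDt hs hu
    have haway : IsRegularRing (Localization.Away t) :=
      TestElement.isRegularRing_away_of_generizations w t hreg''
    revert hc
    rw [hDt]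
    intro hc
    exact Or.inr ⟨hdom, t, htm, ht0, haway, hc⟩
  · exact Or.inl (hreg w hw)

/-- **Chain C's `HullOfRungTwo` implies chain D's `PointwiseHullOfRungTwo`** (the F-injective Cartier
hull of a rung-2 variety is a pointwise-certified model of it). [folklore] -/
theorem pointwiseHullOfRungTwo_of_hullOfRungTwo
    (hH : ∀ (p : ℕ) [Fact p.Prime] (k : Type) [Field k] [CharP k p] (Y : Scheme.{0})
      (g : Y ⟶ Spec (.of k)) [IsSeparated g] [LocallyOfFiniteType g] [QuasiCompact g] [IsIntegral Y],
      (∀ y : Y, IsDomain (Y.presheaf.stalk y) ∧ ∀ d : ℕ, ringKrullDim (Y.presheaf.stalk y) = d →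
        ∀ s : Fin d → Y.presheaf.stalk y, (Ideal.span (Set.range s)).radical.IsMaximal →
          RingTheory.Sequence.IsWeaklyRegular (Y.presheaf.stalk y) (List.ofFn s) ∧
          ∀ w : Y.presheaf.stalk y, (∃ e : ℕ, w ^ p ^ e ∈
            Ideal.span ((fun z : Y.presheaf.stalk y => z ^ p ^ e) ''
              (Ideal.span (Set.range s) : Set (Y.presheaf.stalk y)))) →
            w ∈ Ideal.span (Set.range s)) →
      ∃ (W' : Scheme.{0}) (π : W' ⟶ Y), IsProper π ∧ IsBirational π ∧
        ∃ D' : W'.IdealSheafData, IsEffectiveCartier D' ∧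
          (∀ w : W', w ∉ D'.support → IsRegularLocalRing (W'.presheaf.stalk w)) ∧
          (∀ w : W', w ∈ D'.support → IsDomain (W'.presheaf.stalk w) ∧
            ∀ d : ℕ, ringKrullDim (W'.presheaf.stalk w ⧸ stalkIdeal D' w) = d →
              ∀ t : Fin d → W'.presheaf.stalk w ⧸ stalkIdeal D' w,
                (Ideal.span (Set.range t)).radical.IsMaximal →
                  RingTheory.Sequence.IsWeaklyRegular (W'.presheaf.stalk w ⧸ stalkIdeal D' w)
                    (List.ofFn t) ∧
                  ∀ y : W'.presheaf.stalk w ⧸ stalkIdeal D' w, (∃ e : ℕ, y ^ p ^ e ∈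
                    Ideal.span ((fun z : W'.presheaf.stalk w ⧸ stalkIdeal D' w => z ^ p ^ e) ''
                      (Ideal.span (Set.range t) :
                        Set (W'.presheaf.stalk w ⧸ stalkIdeal D' w)))) →
                    y ∈ Ideal.span (Set.range t)))
    (p : ℕ) [Fact p.Prime] (k : Type) [Field k] [CharP k p] (Y : Scheme.{0})
    (g : Y ⟶ Spec (.of k)) [IsSeparated g] [LocallyOfFiniteType g] [QuasiCompact g] [IsIntegral Y]
    (h₂ : ∀ y : Y, IsDomain (Y.presheaf.stalk y) ∧ ∀ d : ℕ, ringKrullDim (Y.presheaf.stalk y) = d →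
      ∀ s : Fin d → Y.presheaf.stalk y, (Ideal.span (Set.range s)).radical.IsMaximal →
        RingTheory.Sequence.IsWeaklyRegular (Y.presheaf.stalk y) (List.ofFn s) ∧
        ∀ w : Y.presheaf.stalk y, (∃ e : ℕ, w ^ p ^ e ∈
          Ideal.span ((fun z : Y.presheaf.stalk y => z ^ p ^ e) ''
            (Ideal.span (Set.range s) : Set (Y.presheaf.stalk y)))) →
          w ∈ Ideal.span (Set.range s)) :
    ∃ (W' : Scheme.{0}) (π : W' ⟶ Y), IsProper π ∧ IsBirational π ∧ ∀ w : W',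
      IsRegularLocalRing (W'.presheaf.stalk w) ∨
      (IsDomain (W'.presheaf.stalk w) ∧
        ∃ t : W'.presheaf.stalk w, t ∈ maximalIdeal (W'.presheaf.stalk w) ∧ t ≠ 0 ∧
          IsRegularRing (Localization.Away t) ∧
          ∀ d : ℕ, ringKrullDim (W'.presheaf.stalk w ⧸ Ideal.span {t}) = d →
            ∀ u : Fin d → W'.presheaf.stalk w ⧸ Ideal.span {t},
              (Ideal.span (Set.range u)).radical.IsMaximal →
                RingTheory.Sequence.IsWeaklyRegular (W'.presheaf.stalk w ⧸ Ideal.span {t})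
                  (List.ofFn u) ∧
                ∀ y : W'.presheaf.stalk w ⧸ Ideal.span {t}, (∃ e : ℕ, y ^ p ^ e ∈
                  Ideal.span ((fun z : W'.presheaf.stalk w ⧸ Ideal.span {t} => z ^ p ^ e) ''
                    (Ideal.span (Set.range u) : Set (W'.presheaf.stalk w ⧸ Ideal.span {t})))) →
                  y ∈ Ideal.span (Set.range u)) := by
  obtain ⟨W', π', hπ', hbir', D', hD', hreg', hcert⟩ := hH p k Y g h₂
  haveI := hπ'
  exact ⟨W', π', hπ', hbir', pointwiseHull_of_cartierHull p (π' ≫ g) hD' hreg' hcert⟩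

end Summit.ResolutionOfSingularities.ResolutionOfSingularities.Theorems.FRationalModification.PointwiseHull

end
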